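import Mathlib.Tactic.ComputeDegree
import Literature.NumberTheory.EllipticCurves.IsogenyFormulaDegree
import Literature.NumberTheory.EllipticCurves.KubertTateFive
import HarnessLib

/-!
# Vélu's `5`-isogeny of the universal `5`-torsion curve `E_{m,n} = [n-m, -mn, -mn², 0, 0]`
# (class-wide, polynomial in `(m, n)`), and its constant kernel

PROOF-ONLY file (theorems, two curve-valued definitions, one `IsogenyFormula` and one `Isogeny`),
topic `NumberTheory/EllipticCurves`. For the integral model `E_{m,n} = kubertTateFive m n :
y² + (n-m)xy - mn²y = x³ - mnx²` of the universal elliptic curve with a point `T = (0,0)` of order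
`5` (Knapp (5.31), Kubert 1976 Table 3; tree `KubertTateFive`), Vélu's formulae for the subgroup
`⟨T⟩ = {O, (0,0), (0, mn²), (mn, m²n), (mn, 0)}` (kernel polynomial `h = x² - mnx`) give, with
POLYNOMIAL dependence on `(m, n)`:

  `E'_{m,n} = E_{m,n}/⟨T⟩ = [n-m, -mn, -mn², 5mn³ - 10m²n² - 5m³n, mn⁵ - 15m²n⁴ + 5m³n³ - 10m⁴n² - m⁵n]`,
  `Δ(E'_{m,n}) = mn(m² - 11mn - n²)⁵`,
  `U = x⁵ - 2mn x⁴ + (m³n + 3m²n² - mn³) x³ + (3m²n⁴ - 3m³n³) x² + (m⁴n⁴ - 3m³n⁵) x + m⁴n⁶`,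

and `S, T` as below; the two identities of the tree's `IsogenyFormula` (Silverman III.4.8) are
polynomial identities in `ℤ[m, n][x]`, closed by `ring` (`fiveIsogenyFormula`), so that
`fiveIsogeny m n : Isogeny (kubertTateFive m n) (kubertTateFive' m n)` is a term for EVERY `(m, n)`
over any field of characteristic `0` with `E_{m,n}` elliptic. Its kernel is the constant group
`⟨T⟩ = {O, (0,0), (0,mn²), (mn,0), (mn,m²n)}` (`mem_ker_fiveIsogeny_imp`, `natCard_ker_fiveIsogeny`,
`smul_eq_of_mem_ker`), so the tree's étale-kernel descent (`ConstantKernelDescent.selmerGroup_eq_bot`,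
Mazur 1977 III §3 with I §1(g)) applies over `ℚ` in the tame régime — carried out in the sequel
`KubertTateFiveSelmerTame` (`Sel^φ(E_{m,n}/ℚ) = 0` class-wide; T. Fisher, JEMS 3 (2001), §§1–2,
computes these Selmer groups in general). The curve `E_{13/14}` of `KubertTate1314FiveIsogeny` is
the instance `(m, n) = (13, 14)`.

## References

* [Velu1971] J. Vélu, *Isogénies entre courbes elliptiques*, C. R. Acad. Sci. Paris 273 (1971).
* [Kubert1976] D. S. Kubert, *Universal bounds on the torsion of elliptic curves*, Table 3.
* [Mazur1977] B. Mazur, *Modular curves and the Eisenstein ideal*, Ch. III §3, Ch. I §1(g).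
* [Fisher2001FiveSevenDescent] T. Fisher, JEMS 3 (2001) 169–201, §§1–2.
* [SilvermanAEC2009] J. H. Silverman, *AEC*, 2nd ed., Thm. III.4.8, Rem. III.4.13.3, X.4.2.
-/

noncomputable section

open scoped Classical
open Polynomial WeierstrassCurve NumberField IsDedekindDomain Field
open Literature.NumberTheory.EllipticCurves Literature.NumberTheory.GaloisRepresentations

universe u

namespace Literature.NumberTheory.EllipticCurves

namespace KubertTateVelu

/-! ### The isogenous curve `E'_{m,n}` -/

section Ring

variable {R : Type*} [CommRing R] (m n : R)

/-- **`E'_{m,n} = E_{m,n}/⟨(0,0)⟩`** (Vélu): `[n-m, -mn, -mn², 5mn³ - 10m²n² - 5m³n,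
mn⁵ - 15m²n⁴ + 5m³n³ - 10m⁴n² - m⁵n]`. [cite: Velu1971, formulae] -/
def kubertTateFive' : WeierstrassCurve R where
  a₁ := n - m
  a₂ := -(m * n)
  a₃ := -(m * n ^ 2)
  a₄ := 5 * m * n ^ 3 - 10 * m ^ 2 * n ^ 2 - 5 * m ^ 3 * n
  a₆ := m * n ^ 5 - 15 * m ^ 2 * n ^ 4 + 5 * m ^ 3 * n ^ 3 - 10 * m ^ 4 * n ^ 2 - m ^ 5 * n

/-- `E'_{m,n}` commutes with ring homomorphisms. [cite: Velu1971, formulae] -/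
theorem map_kubertTateFive' {S : Type*} [CommRing S] (f : R →+* S) :
    (kubertTateFive' m n).map f = kubertTateFive' (f m) (f n) := by
  ext <;> simp [kubertTateFive', WeierstrassCurve.map, map_ofNat]

/-- **`Δ(E'_{m,n}) = mn(m² - 11mn - n²)⁵`.** [cite: Velu1971, formulae] -/
theorem kubertTateFive'_Δ :
    (kubertTateFive' m n).Δ = m * n * (m ^ 2 - 11 * m * n - n ^ 2) ^ 5 := by
  simp only [kubertTateFive', Δ, b₂, b₄, b₆, b₈]
  ring

end Ring

/-! ### Vélu's formula as an `IsogenyFormula` (identities by `ring`) -/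

section Field

variable {K : Type u} [Field K] (m n : K)

/-- Vélu's numerator `U`. [cite: Velu1971, formulae] -/
def veluU : K[X] :=
  X ^ 5 - 2 * C m * C n * X ^ 4 + (C m ^ 3 * C n + 3 * C m ^ 2 * C n ^ 2 - C m * C n ^ 3) * X ^ 3
    + (3 * C m ^ 2 * C n ^ 4 - 3 * C m ^ 3 * C n ^ 3) * X ^ 2
    + (C m ^ 4 * C n ^ 4 - 3 * C m ^ 3 * C n ^ 5) * X + C m ^ 4 * C n ^ 6

/-- The kernel polynomial `h = x² - mnx = x(x - mn)`. [cite: Velu1971, formulae] -/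
def veluH : K[X] := X ^ 2 - C m * C n * X

/-- Vélu's `S` (coefficient of `y` in the second coordinate). [cite: Velu1971, formulae] -/
def veluS : K[X] :=
  X ^ 6 - 3 * C m * C n * X ^ 5 + (C m * C n ^ 3 + C m ^ 2 * C n ^ 2 - C m ^ 3 * C n) * X ^ 4
    + (-5 * C m ^ 2 * C n ^ 4 + 3 * C m ^ 3 * C n ^ 3 - C m ^ 4 * C n ^ 2) * X ^ 3
    + (9 * C m ^ 3 * C n ^ 5 - 3 * C m ^ 4 * C n ^ 4) * X ^ 2
    + (-7 * C m ^ 4 * C n ^ 6 + C m ^ 5 * C n ^ 5) * X + 2 * C m ^ 5 * C n ^ 7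

/-- Vélu's `T` (the `y`-free part of the second coordinate). [cite: Velu1971, formulae] -/
def veluT : K[X] :=
  (C m * C n ^ 4 - 3 * C m ^ 2 * C n ^ 3 + C m ^ 3 * C n ^ 2 + C m ^ 4 * C n) * X ^ 5
    + (-5 * C m ^ 2 * C n ^ 5 + 10 * C m ^ 3 * C n ^ 4 - 4 * C m ^ 4 * C n ^ 3) * X ^ 4
    + (10 * C m ^ 3 * C n ^ 6 - 13 * C m ^ 4 * C n ^ 5 + 4 * C m ^ 5 * C n ^ 4) * X ^ 3
    + (-10 * C m ^ 4 * C n ^ 7 + 8 * C m ^ 5 * C n ^ 6 - C m ^ 6 * C n ^ 5) * X ^ 2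
    + (5 * C m ^ 5 * C n ^ 8 - 2 * C m ^ 6 * C n ^ 7) * X - C m ^ 6 * C n ^ 9

/-- `deg U = 5` (monic). [cite: Velu1971, formulae] -/
theorem natDegree_veluU : (veluU m n).natDegree = 5 := by
  unfold veluU; compute_degree!

/-- `deg h ≤ 2`. [cite: Velu1971, formulae] -/
theorem natDegree_veluH_le : (veluH m n).natDegree ≤ 2 := by
  unfold veluH; compute_degree

/-- `h ≠ 0` (it is monic of degree `2`). [cite: Velu1971, formulae] -/
theorem veluH_ne_zero : veluH m n ≠ 0 := by
  intro h0
  have := congrArg (fun p : K[X] ↦ p.coeff 2) h0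
  simp [veluH, coeff_X_pow] at this

/-- **Vélu's `5`-isogeny formula `E_{m,n} → E'_{m,n}`** as a term of the tree's `IsogenyFormula`
(Silverman *AEC* III.4.8): both identities are polynomial identities in `m, n, x`.
[cite: Velu1971, formulae; SilvermanAEC2009, Thm. III.4.8 and Rem. III.4.13.3] -/
def fiveIsogenyFormula : IsogenyFormula (kubertTateFive m n) (kubertTateFive' m n) where
  U := veluU m n
  h := veluH m n
  S := veluS m n
  T := veluT m n
  identity₁ := by
    simp only [veluU, veluH, veluS, veluT, kubertTateFive, kubertTateFive', map_sub, map_neg, map_mul,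
      map_pow]
    ring
  identity₀ := by
    simp only [veluU, veluH, veluS, veluT, kubertTateFive, kubertTateFive', map_sub, map_neg, map_mul,
      map_pow, map_add, map_ofNat, map_zero, add_zero]
    ring
  h_ne_zero := veluH_ne_zero m n
  natDegree_lt := by
    calc ((veluH m n) ^ 2).natDegree ≤ 2 * (veluH m n).natDegree := natDegree_pow_le
      _ ≤ 2 * 2 := Nat.mul_le_mul_left 2 (natDegree_veluH_le m n)
      _ < 5 := by norm_num
      _ = (veluU m n).natDegree := (natDegree_veluU m n).symm

/-- `U = x · q₀ + m⁴n⁶` and `U = (x - mn) · q₁ + m⁶n⁴`: `U(0) = m⁴n⁶`, `U(mn) = m⁶n⁴`, so `U` is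
coprime to `h = x(x - mn)` when `mn ≠ 0`. [cite: SilvermanAEC2009, Rem. III.4.13.3] -/
theorem isCoprime_veluU_veluH (hm : m ≠ 0) (hn : n ≠ 0) : IsCoprime (veluU m n) (veluH m n) := by
  have hc0 : m ^ 4 * n ^ 6 ≠ 0 := mul_ne_zero (pow_ne_zero 4 hm) (pow_ne_zero 6 hn)
  have hc1 : m ^ 6 * n ^ 4 ≠ 0 := mul_ne_zero (pow_ne_zero 6 hm) (pow_ne_zero 4 hn)
  set q₀ : K[X] := X ^ 4 - 2 * C m * C n * X ^ 3 + (-C m * C n ^ 3 + 3 * C m ^ 2 * C n ^ 2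
      + C m ^ 3 * C n) * X ^ 2 + (3 * C m ^ 2 * C n ^ 4 - 3 * C m ^ 3 * C n ^ 3) * X
      + (-3 * C m ^ 3 * C n ^ 5 + C m ^ 4 * C n ^ 4) with hq₀
  set q₁ : K[X] := X ^ 4 - C m * C n * X ^ 3 + (-C m * C n ^ 3 + 2 * C m ^ 2 * C n ^ 2
      + C m ^ 3 * C n) * X ^ 2 + (2 * C m ^ 2 * C n ^ 4 - C m ^ 3 * C n ^ 3 + C m ^ 4 * C n ^ 2) * X
      + (-C m ^ 3 * C n ^ 5 + C m ^ 5 * C n ^ 3) with hq₁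
  have hU0 : veluU m n - X * q₀ = C (m ^ 4 * n ^ 6) := by
    rw [hq₀, veluU, map_mul, map_pow, map_pow]; ring
  have hU1 : veluU m n - (X - C (m * n)) * q₁ = C (m ^ 6 * n ^ 4) := by
    rw [hq₁, veluU, map_mul, map_mul, map_pow, map_pow]; ring
  have h1 : IsCoprime (veluU m n) X := by
    refine ⟨C (m ^ 4 * n ^ 6)⁻¹, -(C (m ^ 4 * n ^ 6)⁻¹ * q₀), ?_⟩
    calc C (m ^ 4 * n ^ 6)⁻¹ * veluU m n + -(C (m ^ 4 * n ^ 6)⁻¹ * q₀) * X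
        = C (m ^ 4 * n ^ 6)⁻¹ * (veluU m n - X * q₀) := by ring
      _ = 1 := by rw [hU0, ← map_mul, inv_mul_cancel₀ hc0, map_one]
  have h2 : IsCoprime (veluU m n) (X - C (m * n)) := by
    refine ⟨C (m ^ 6 * n ^ 4)⁻¹, -(C (m ^ 6 * n ^ 4)⁻¹ * q₁), ?_⟩
    calc C (m ^ 6 * n ^ 4)⁻¹ * veluU m n + -(C (m ^ 6 * n ^ 4)⁻¹ * q₁) * (X - C (m * n))
        = C (m ^ 6 * n ^ 4)⁻¹ * (veluU m n - (X - C (m * n)) * q₁) := by ring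
      _ = 1 := by rw [hU1, ← map_mul, inv_mul_cancel₀ hc1, map_one]
  have hh : veluH m n = X * (X - C (m * n)) := by rw [veluH, map_mul]; ring
  rw [hh]
  exact h1.mul_right h2

/-! ### The isogeny and its kernel -/

variable [CharZero K] [hE : (kubertTateFive m n).IsElliptic]

omit [CharZero K] in
/-- `m ≠ 0`, `n ≠ 0` and `m² - 11mn - n² ≠ 0` when `E_{m,n}` is elliptic. [cite: Knapp1993, (5.31)] -/
theorem ne_zero_of_isElliptic : m ≠ 0 ∧ n ≠ 0 ∧ m ^ 2 - 11 * m * n - n ^ 2 ≠ 0 := by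
  have h := hE.isUnit.ne_zero
  rw [kubertTateFive_Δ] at h
  refine ⟨fun h0 ↦ h ?_, fun h0 ↦ h ?_, fun h0 ↦ h ?_⟩
  · rw [h0]; ring
  · rw [h0]; ring
  · rw [h0]; ring

/-- `E'_{m,n}` is elliptic when `E_{m,n}` is (`Δ' = mn(m² - 11mn - n²)⁵`). [cite: Velu1971, formulae] -/
instance isElliptic_kubertTateFive' : (kubertTateFive' m n).IsElliptic := by
  obtain ⟨hm, hn, hq⟩ := ne_zero_of_isElliptic m n
  refine ⟨?_⟩
  rw [kubertTateFive'_Δ]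
  exact (mul_ne_zero (mul_ne_zero hm hn) (pow_ne_zero 5 hq)).isUnit

/-- **Vélu's `5`-isogeny `φ : E_{m,n} → E'_{m,n} = E_{m,n}/⟨(0,0)⟩`** (tree `IsogenyFormula.toIsogeny`,
Silverman III.4.8). [cite: Velu1971, formulae; SilvermanAEC2009, Thm. III.4.8] -/
def fiveIsogeny : Isogeny (kubertTateFive m n) (kubertTateFive' m n) :=
  (fiveIsogenyFormula m n).toIsogeny

omit [CharZero K] hE in
/-- Evaluation of `h` over `K̄`: `h(x) = x² - mn x`. [cite: Velu1971, formulae] -/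
theorem eval_geom_h (x : AlgebraicClosure K) :
    (fiveIsogenyFormula m n).geom.h.eval x =
      x ^ 2 - algebraMap K (AlgebraicClosure K) m * algebraMap K (AlgebraicClosure K) n * x := by
  show ((veluH m n).map (algebraMap K (AlgebraicClosure K))).eval x = _
  simp [veluH]

/-- Off `h = 0` the value of `φ` is an affine point, hence non-zero. [cite: SilvermanAEC2009, Thm. III.4.8] -/
theorem fiveIsogeny_some_ne_zero {x y : AlgebraicClosure K}
    (hxy : ((kubertTateFive m n).baseChange (AlgebraicClosure K)).toAffine.Nonsingular x y)
    (hx : x ^ 2 - algebraMap K (AlgebraicClosure K) m * algebraMap K (AlgebraicClosure K) n * x ≠ 0) :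
    fiveIsogeny m n (Affine.Point.some x y hxy) ≠ 0 := by
  have e := (fiveIsogenyFormula m n).toIsogeny_some hxy (by rwa [eval_geom_h])
  change (fiveIsogenyFormula m n).toIsogeny (Affine.Point.some x y hxy) ≠ 0
  rw [e]
  exact Affine.Point.some_ne_zero _

/-- The nonsingular `K̄`-points of `E_{m,n}` are the solutions of `y² + (n-m)xy - mn²y = x³ - mnx²`.
[cite: Knapp1993, (5.31)] -/
theorem nonsingular_geom_iff (x y : AlgebraicClosure K) :
    ((kubertTateFive m n).baseChange (AlgebraicClosure K)).toAffine.Nonsingular x y ↔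
      y ^ 2 + (algebraMap K (AlgebraicClosure K) n - algebraMap K (AlgebraicClosure K) m) * x * y -
        algebraMap K (AlgebraicClosure K) m * algebraMap K (AlgebraicClosure K) n ^ 2 * y =
          x ^ 3 - algebraMap K (AlgebraicClosure K) m * algebraMap K (AlgebraicClosure K) n * x ^ 2 := by
  have hΔ : ((kubertTateFive m n).baseChange (AlgebraicClosure K)).Δ ≠ 0 := by
    rw [WeierstrassCurve.baseChange, map_Δ]
    exact (_root_.map_ne_zero _).mpr hE.isUnit.ne_zero
  rw [← Affine.equation_iff_nonsingular_of_Δ_ne_zero hΔ, Affine.equation_iff]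
  simp only [WeierstrassCurve.baseChange, map_a₁, map_a₂, map_a₃, map_a₄, map_a₆, kubertTateFive_a₁,
    kubertTateFive_a₂, kubertTateFive_a₃, kubertTateFive_a₄, kubertTateFive_a₆, map_zero, map_neg,
    map_sub, map_mul, map_pow]
  constructor <;> intro h <;> linear_combination h

/-- **The kernel of `φ` lies in `{O, (0,0), (0,mn²), (mn, m²n), (mn, 0)}`.** [cite: Velu1971, formulae] -/
theorem mem_ker_fiveIsogeny_imp {P : geomPoints (kubertTateFive m n)} (hP : fiveIsogeny m n P = 0) :
    P = 0 ∨ ∃ (x y : AlgebraicClosure K) (h : _), P = Affine.Point.some x y h ∧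
      ((x = 0 ∧ (y = 0 ∨ y = algebraMap K (AlgebraicClosure K) (m * n ^ 2))) ∨
        (x = algebraMap K (AlgebraicClosure K) (m * n) ∧
          (y = 0 ∨ y = algebraMap K (AlgebraicClosure K) (m ^ 2 * n)))) := by
  rcases P with _ | ⟨x, y, hxy⟩
  · exact Or.inl rfl
  right
  refine ⟨x, y, hxy, rfl, ?_⟩
  set m' := algebraMap K (AlgebraicClosure K) m
  set n' := algebraMap K (AlgebraicClosure K) n
  have hx : x ^ 2 - m' * n' * x = 0 := by
    by_contra hx
    exact fiveIsogeny_some_ne_zero m n hxy hx hP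
  have heq := (nonsingular_geom_iff m n x y).mp hxy
  have hx' : x = 0 ∨ x = m' * n' := by
    have : x * (x - m' * n') = 0 := by linear_combination hx
    rcases mul_eq_zero.mp this with h0 | h1
    · exact Or.inl h0
    · exact Or.inr (by linear_combination h1)
  rcases hx' with rfl | rfl
  · left
    refine ⟨rfl, ?_⟩
    have hy : y * (y - m' * n' ^ 2) = 0 := by linear_combination heq
    rcases mul_eq_zero.mp hy with h0 | h1
    · exact Or.inl h0
    · right; rw [map_mul, map_pow]; linear_combination h1
  · right
    refine ⟨by rw [map_mul], ?_⟩
    have hy : y * (y - m' ^ 2 * n') = 0 := by linear_combination heq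
    rcases mul_eq_zero.mp hy with h0 | h1
    · exact Or.inl h0
    · right; rw [map_mul, map_pow]; linear_combination h1

/-- **`#ker φ = 5`** (`= deg U`; tree `IsogenyFormula.degree_toIsogeny` with `U`, `h` coprime).
[cite: SilvermanAEC2009, Thm. III.4.10(c) and Rem. III.4.13.3] -/
theorem natCard_ker_fiveIsogeny : Nat.card (fiveIsogeny m n).toAddMonoidHom.ker = 5 := by
  obtain ⟨hm, hn, -⟩ := ne_zero_of_isElliptic m n
  have h := (fiveIsogenyFormula m n).degree_toIsogeny
    ((isCoprime_veluU_veluH m n hm hn).map (Polynomial.mapRingHom (algebraMap K (AlgebraicClosure K))))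
  have hU : (fiveIsogenyFormula m n).U.natDegree = 5 := natDegree_veluU m n
  rw [hU] at h
  exact h

/-- `5 • P = O` for every `P ∈ ker φ`. [cite: SilvermanAEC2009, Thm. III.4.10(c)] -/
theorem five_nsmul_eq_zero_of_mem_ker {P : geomPoints (kubertTateFive m n)}
    (hP : P ∈ (fiveIsogeny m n).toAddMonoidHom.ker) : (5 : ℕ) • P = 0 := by
  haveI : Finite (fiveIsogeny m n).toAddMonoidHom.ker := (fiveIsogeny m n).finite_ker'
  have h := addOrderOf_dvd_natCard (⟨P, hP⟩ : (fiveIsogeny m n).toAddMonoidHom.ker)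
  rw [natCard_ker_fiveIsogeny, AddSubgroup.addOrderOf_mk] at h
  exact addOrderOf_dvd_iff_nsmul_eq_zero.mp h

/-- Two affine points with equal coordinates are equal (proof-irrelevant form). [folklore] -/
private theorem some_eq_some_of_eq {R : Type*} [CommRing R] {V : WeierstrassCurve R}
    {x y x' y' : R} (hx : x = x') (hy : y = y') (h : V.toAffine.Nonsingular x y)
    (h' : V.toAffine.Nonsingular x' y') : Affine.Point.some x y h = Affine.Point.some x' y' h' := by
  subst hx hy; rfl

/-- **`Γ_K` fixes every point of `ker φ`** (all five are `K`-rational). [cite: Mazur1977, Ch. III §3 (the constant subgroup C)] -/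
theorem smul_eq_of_mem_ker (σ : absoluteGaloisGroup K) (P : geomPoints (kubertTateFive m n))
    (hP : P ∈ (fiveIsogeny m n).toAddMonoidHom.ker) : σ • P = P := by
  have hP' : fiveIsogeny m n P = 0 := hP
  rcases mem_ker_fiveIsogeny_imp m n hP' with rfl | ⟨x, y, h, rfl, hxy⟩
  · exact smul_zero σ
  letI : Algebra K (AlgebraicClosure K) := AlgebraicClosure.instAlgebra K
  set τ : AlgebraicClosure K ≃ₐ[K] AlgebraicClosure K := absoluteGaloisGroup.toAlgEquiv K σ with hτ
  have e := Affine.Point.map_some (W' := (kubertTateFive m n).toAffine)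
    (τ : AlgebraicClosure K →ₐ[K] AlgebraicClosure K) h
  refine e.trans (some_eq_some_of_eq ?_ ?_ _ _)
  · rcases hxy with ⟨rfl, -⟩ | ⟨rfl, -⟩
    · exact map_zero _
    · exact τ.commutes _
  · rcases hxy with ⟨-, rfl | rfl⟩ | ⟨-, rfl | rfl⟩
    · exact map_zero _
    · exact τ.commutes _
    · exact map_zero _
    · exact τ.commutes _

end Field

end KubertTateVelu

end Literature.NumberTheory.EllipticCurves

end
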